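import Literature.MathematicalPhysics.QuantumFieldTheory.Balaban1983to89.B8Eq156Prop4
import Literature.MathematicalPhysics.QuantumFieldTheory.Balaban1983to89.B7LocalityGeneral
import Literature.MathematicalPhysics.QuantumFieldTheory.Balaban1983to89.B8ConstraintBonds

/-!
# `Balaban1983to89.B8Eq156KLevelLocal` — [Balaban1985RegularSpaces] Sect. B p. 86: (1.56)
# «Q_j(U₀, ηA) = LʲηQ_jA + C_j(LʲηA), |C_j(LʲηA)| ≦ C₂|LʲηA|² < C₂α₂²» and «|B₁| < 2dLα₁ + C₂α₂²» AT ONE BOND `c`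
# OF `Λ_j` FROM THE DATA IN THE BOX `B^j(c₋) ∪ B^j(c₊)` ONLY, at a GENERAL background, and the k-level form
# «on Λ_j, j = 0, …, k» for a GENERAL family `{Ω_j}` from the LEVEL-WISE (1.40)/(1.41)/(1.42)

statement-level skeleton of published theorems with citation tags; proofs where landed; nothing here is a claim about the Yang–Mills mass gap

T. Bałaban, *Spaces of regular gauge field configurations on a lattice and gauge fixing conditions*, Commun.
Math. Phys. **99** (1985) 75–102 `[Balaban1985RegularSpaces]` ("B8"; printed page = PDF page + 74), p. 86 [PDF 12];
[3] = T. Bałaban, *Averaging operations for lattice gauge theories*, Commun. Math. Phys. **98** (1985) 17–51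
`[Balaban1985Averaging]` ("B7"; printed page = PDF page + 16), Prop. 4 p. 38 and the locality sentence p. 24.
PDF held: `paper:balaban1985-cmp99-regular-spaces-gauge-fixing` (pp. 83, 86 read as text).  STATUS: published, refereed.

CITATION HEADER (lean-in-tree rule).  Cell `pub-ymgap` (YM Track A, DAG node N05 = [B8], HUMAN RULING D-0062), seat
`pub-ymgap-dag-n05-b` (FIRST-MISSING-ESTIMATE of Theorem 2 p. 83), gen 0; second section module of the k-level «on Ω_j»
reading of Sect. B (companion of `B8Eq155KLevelLocal`).  WHAT IS REPRODUCED = lit-balaban SKELETON row **B8.Eq1.56** (and the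
sentence after it) in print's generality: the tree's `B8Eq156Prop4.eq156_of_141` / `norm_B1_lt` / `wsup_B1_le` (p40) prove
(1.56) at one level `j` from GLOBAL hypotheses — `pdev U₀ < α₀L^{−2j}` for ALL plaquettes of `ℤᵈ` and (1.41) on ALL bonds
(`B7Eq123General.prop4_general` is global) —, which is not print's situation for a nested family `{Ω_j}` (the level-`j`
thresholds hold on `Ω_j` only).  This file LOCALISES them, by [3]'s locality «Ū^k_c depends only on the bond variables
U_b for b ⊂ B^k(c₋) ∪ B^k(c₊)» (p. 24; kernel: `B7LocalityGeneral.logCovIter_congr`, r20, + the linear companion proved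
here) and b07's clamped-extension device `B7Prop1Local.clampCfg` («a local hypothesis (44) on the box becomes a global one»):
(1.56) at the bond `c` of the `j`-lattice needs `U₀`'s plaquettes and `A`'s bond values INSIDE `B^j(c₋) ∪ B^j(c₊)` only — for
`c ⊂ Λ_j ⊂ Ω_j^{(j)}` these lie in `Ω_j`, where (1.40)/(1.41) give exactly the level-`j` thresholds.  Kind «kernel-checked
proof», theorems only: no `def`, no `… : Prop` fact, no existing module modified.  REUSED BY NAME: `B8Eq156Prop4.{eq156_of_141,
B1_eq}`, `B7LocalityGeneral.{logCovIter_congr, Qcov_congr}`, `B7Prop1Local.{clampCfg, clampCfg_agree, clampCfg_mem,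
pdev_clampCfg_le, avgIter_congr, InBox, AgreeOn, PlaqIn, loK, bondHiK, bondHi}`, `B7Prop5Flat.{BondIn, bondsIn, restr,
insCfg_restr_of_mem, mem_bondsIn, agreeOn_insCfg_restr, inBox_nest}`, `B7Prop3Flat.insCfg`, `B7Prop3GeneralLinear.linQcov`,
`B7Prop4GeneralLevels.{logCovIter, linCovIter, linCovIter_succ}`, `B8Ineq132.{pdevOn_lt_of_forall, CondAt, InAk, plaqF}`,
`B8Eq155JBound.{wsup, wsup_le}`, `B8ConstraintBonds.DomainSeq`, `QuantumLattice.BalabanRG.{blockMap, blockBase, blockMap_blockBase}`.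

## THE PRINTED TEXT (p. 86 [PDF 12]; p. 83 [PDF 9] for (1.41)/(1.42))

«The configuration A satisfies (1.42) also. Proposition 4 from [3] implies that
Q_j(U₀, ηA) = LʲηQ_jA + C_j(LʲηA), |C_j(LʲηA)| ≦ C₂|LʲηA|² < C₂α₂², (1.56)
hence LʲηQ_jA = B₁, B₁ = B − C_j(LʲηA) on Λ_j, |B₁| < 2dLα₁ + C₂α₂².»  with (1.41) «U₁ = e^{iηA}, |A| < α₂(Lʲη)⁻¹ on
Ω_j» and (1.42) «R(U₀)D^{η*}_{U₀}A = 0, Q_j(U₀, ηA) = B on Λ_j, |B| < 2dLα₁» (p. 83), «(j = 0, 1, …, k above)».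
[3] p. 24: «this definition is local in the sense that Ū^k_c, c ⊂ Ω^{(k)}, depends only on the bond variables U_b for
b ⊂ B^k(c₋) ∪ B^k(c₊). This property will play a very important role in the future.»

## WHAT IS CERTIFIED HERE (kernel; axioms `propext` / `Classical.choice` / `Quot.sound`)

On the `ℤᵈ` carriers of the lineage (`B7Prop1Explicit`: sites `Fin d → ℤ`; `U₀` with values in an averaging-closed gauge
group `G ≤ U1`, `B7Prop2Explicit.AvgClosed`; `B = iηA`; `Q_j(U₀, ηA)` = `B7Prop4GeneralLevels.logCovIter`, `LʲηQ_jA` =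
`linCovIter`; the box `B^j(c₋) ∪ B^j(c₊)` of the bond `c = ⟨z, z + e_κ⟩` of the `j`-lattice = `[loK L j z, bondHiK L j z κ]`):
* §1 LOCALITY OF THE LINEAR AVERAGING (private plumbing; public twins exist on the Summits side in
  `…T4Continuum.Support.ShellMeasureAverageLocality148`, not importable here): `linQcov_congr` (one step, [3] (122)),
  `linCovIter_congr` — `LʲηQ_jA(c)` depends on `U₀` and `A` through the bonds of `B^j(c₋) ∪ B^j(c₊)` only.
* §2 **(1.56) AT ONE BOND FROM BOX DATA** (`eq156_loc`): if `|U₀(∂p) − 1| < α₀L^{−2j}` for the plaquettes `p ⊂ B^j(c₋) ∪ B^j(c₊)`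
  and `|A(b)| ≤ α₂(Lʲη)⁻¹` for the bonds `b` there, then `|C_j(LʲηA)(c)| = |Q_j(U₀, ηA)(c) − LʲηQ_jA(c)| ≤ C₂α₂²`,
  `C₂ = C₂(d, α₀) = 8C₁e^{4cα₀}` (the constant of `B8Eq156Prop4`), under the [3]-Prop.-2/Prop.-4 windows of that file.
  Proof: the GLOBAL theorem applied to the clamped extension `π^*U₀` (every plaquette variable is `1` or one inside the box)
  and the restriction `A|_{box}` (zero outside), then transported back by locality.
* §3 **«|B₁| < 2dLα₁ + C₂α₂²» AT ONE BOND** (`norm_B1_lt_loc`): with (1.42) `|Q_j(U₀, ηA)(c)| < 2dLα₁` at `c`.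
* §5 **THE BOX HYPOTHESIS FROM THE ADMISSIBILITY RECORD** (`blockMap_of_inBox_loK`, `mem_of_inBox_of_domainSeq`,
  `hbox_of_domainSeq`): under the tree's (1.3)/(1.4) record `B8ConstraintBonds.DomainSeq L Ω` (each `Ω_j` a union of
  `j`-blocks), the box of a bond whose two block corners lie in `Ω_j` lies in `Ω_j` — the hypothesis `hbox` of §4 discharged
  for such `Λ`.
* §4 **THE k-LEVEL FORM FOR A GENERAL FAMILY** (`norm_B1_lt_kLevel`, `wsup_B1_le_kLevel`): for constraint bond sets
  `Λ_j` (`j ≤ k`) of the `j`-lattices whose boxes lie in `Ω_j` («Λ_j ⊂ Ω_j^{(j)}», (1.5)), the level-wise (1.40)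
  `U₀ ∈ 𝔄_k({Ω_j}, α₀)` (`B8Ineq132.InAk`, plaquette clause), (1.41) on the bonds touching `Ω_j` (p. 77 convention) and
  (1.42) on `Λ_j` give `|LʲηQ_jA(c)| < 2dLα₁ + C₂α₂²` at every `c ∈ Λ_j`, `j ≤ k`, and hence for the supremum
  `|B₁| := sup_{j ≤ k} sup_{c ∈ Λ_j}|LʲηQ_jA(c)|` (the weight-`1` instance of `B8Eq155JBound.wsup`, the shape of the
  hypothesis `h56` of `B8.apriori_160`): `|B₁| ≤ 2dLα₁ + C₂α₂²`.

## HONEST SCOPE / LOCATED READING — what is NOT claimed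

(i) Constants, windows and side conditions are EXACTLY those of `B8Eq156Prop4` (`C₀α₀ ≤ 1/3`, `4α₀ ≤ c₂′(d, L)`,
`e^{4cα₀}(1 + 8C₁α₂) ≤ 2`, `2α₂ ≤ c₃(d, L)`, `L ≥ 2`, `C₂(d, α₀) = 8C₁e^{4cα₀}`); only the quantifiers of the hypotheses
shrink to the box.  (ii) The box hypothesis of §4 — every site of `B^j(c₋) ∪ B^j(c₊)` lies in `Ω_j` for `c ∈ Λ_j` — is
print's «Λ_j ⊂ Ω_j^{(j)}, Ω_j = Bʲ(Ω_j^{(j)})» ((1.3)/(1.5) p. 77); it is taken as a hypothesis on the pair `(Ω, Λ)` in §4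
and derived in §5 from the tree's `DomainSeq` record for bonds with both block corners in `Ω_j` (the boundary bonds of `Λ_j`
whose outer corner leaves `Ω_j^{(j)}` are print's one-block boundary layer, cell GAPS G-adv8-11, and are not covered).  (iii) (1.41) is read on the bonds with BOTH end-points in the box (⊆ the bonds
touching `Ω_j` under (ii)) with `≤` for print's `<`; (1.42)'s first clause (the Landau condition) is not used by (1.56) and
not typed.  (iv) `T_η` ↦ `ℤᵈ`, `η > 0` explicit; NOT HERE: (1.57)–(1.62) (see `B8Eq155KLevelLocal` §5, `B8Prop3Concrete`,
`B8Eq157Translation`), the torus.  Nothing here is progress on the summit; the value is the k-level «on Λ_j» certificate of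
(1.56) at a general background — the second display of the printed proof of Theorem 2 (pp. 83–88) that the tree had only
with global hypotheses.
-/

noncomputable section

open scoped BigOperators
open NormedSpace

namespace Literature.MathematicalPhysics.QuantumFieldTheory.Balaban1983to89.B8Eq156KLevelLocal

open B7Prop1Explicit (U1 e)
open B7Prop1Local (InBox AgreeOn PlaqIn loK bondHiK bondHi clampCfg clampCfg_agree clampCfg_mem pdev_clampCfg_le
  avgIter_congr add_e_apply)
open B7Prop2Explicit (pdev AvgClosed C0 c2' avgIter)
open B7Prop3Flat (c3 insCfg)
open B7Prop5Flat (BondIn bondsIn restr insCfg_restr_of_mem mem_bondsIn agreeOn_insCfg_restr inBox_nest)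
open B7Prop3GeneralLinear (Qcov linQcov)
open B7Prop4GeneralLevels (logCovIter linCovIter linCovIter_succ)
open B7LocalityGeneral (logCovIter_congr Qcov_congr)
open B8Ineq132 (plaqF pdevOn_lt_of_forall CondAt InAk PlaqTouches BondTouches)
open B8Eq146AExpansion (iEta)
open B8Eq155JBound (wsup wsup_le)
open B8Eq156Prop4 (eq156_of_141 B1_eq)

-- `Site` alone would resolve to the torus sites of `Setup.lean`; re-export the `ℤ^d` sites of `B7Prop1Explicit`.
export B7Prop1Explicit (Site)

variable {d : ℕ}

/-! ## §1 Locality of the linear averaging `LʲηQ_jA` -/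

section Locality

variable {𝔸 : Type*} [NormedRing 𝔸] [NormedAlgebra ℂ 𝔸] [CompleteSpace 𝔸]

/-- **Locality of the one-step linear part (122)** «L(Q(V₀)A)_c», jointly in `(V₀, A)`: bonds of `B(c₋) ∪ B(c₊)` — it is the
`t`-derivative at `0` of `Q(V₀, tA, c)`, which is local by `B7LocalityGeneral.Qcov_congr`.  (Private: a public twin with the same
statement lives on the Summits side, `Summit.QuantumFields.BalabanUV.T4Continuum.ShellMeasureAverageLocality148.linQcov_congr`, which a
`Literature/` module cannot import.) [cite: Balaban1985Averaging, (122) p.36, p.24] -/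
private theorem linQcov_congr (L : ℕ) (hL : 1 ≤ L) (q : Site d) (κ : Fin d) {V₀ V₀' : Site d → Fin d → 𝔸ˣ}
    {A A' : Site d → Fin d → 𝔸} (h₀ : AgreeOn q (bondHi L q κ) V₀ V₀') (hA : AgreeOn q (bondHi L q κ) A A') :
    linQcov L V₀ A q κ = linQcov L V₀' A' q κ := by
  unfold linQcov
  congr 1
  funext t
  exact Qcov_congr L hL q κ h₀ fun x μ hx hxe => by
    show t • A x μ = t • A' x μ
    rw [hA x μ hx hxe]

/-- **LOCALITY OF THE COMPOSITE LINEAR AVERAGING `LʲηQ_jA` (p. 38 «Q_{j+1}(U₀) = Q(Ū₀ʲ)Q_j(U₀)») AT A GENERAL BACKGROUND**: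
`LʲηQ_jA(c)`, `c = ⟨z, z + e_κ⟩` of the `j`-th lattice, depends only on the bond variables of `U₀` AND of `A` in
`B^j(c₋) ∪ B^j(c₊) = [L^jz, L^jz + (L^j − 1)𝟙 + L^je_κ]` — the linear companion of `B7LocalityGeneral.logCovIter_congr`.
(Private: public twin `Summit.QuantumFields.BalabanUV.T4Continuum.ShellMeasureAverageLocality148.linCovIter_congr` on the Summits
side, not importable from `Literature/`.) [cite: Balaban1985Averaging, p.24 (after (43)), p.38 (before (133))] -/
private theorem linCovIter_congr (L : ℕ) (hL : 1 ≤ L) :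
    ∀ (j : ℕ) {U₀ U₀' : Site d → Fin d → 𝔸ˣ} {B B' : Site d → Fin d → 𝔸} (z : Site d) (κ : Fin d),
      AgreeOn (loK L j z) (bondHiK L j z κ) U₀ U₀' → AgreeOn (loK L j z) (bondHiK L j z κ) B B' →
        linCovIter L U₀ B j z κ = linCovIter L U₀' B' j z κ
  | 0, U₀, U₀', B, B', z, κ, _, h => by
    refine h z κ (fun i => ?_) (fun i => ?_)
    · simp only [loK, bondHiK, pow_zero, one_mul]; split_ifs <;> omega
    · simp only [loK, bondHiK, pow_zero, one_mul, add_e_apply]; split_ifs <;> omega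
  | j + 1, U₀, U₀', B, B', z, κ, h₀, h => by
    rw [linCovIter_succ, linCovIter_succ]
    refine linQcov_congr L hL _ κ (fun x μ hx hxe => ?_) (fun x μ hx hxe => ?_)
    · exact avgIter_congr L hL j x μ fun p ν hp hpν =>
        h₀ p ν (inBox_nest L j z κ ⟨hx, hxe⟩ hp) (inBox_nest L j z κ ⟨hx, hxe⟩ hpν)
    · exact linCovIter_congr L hL j x μ
        (fun p ν hp hpν => h₀ p ν (inBox_nest L j z κ ⟨hx, hxe⟩ hp) (inBox_nest L j z κ ⟨hx, hxe⟩ hpν))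
        (fun p ν hp hpν => h p ν (inBox_nest L j z κ ⟨hx, hxe⟩ hp) (inBox_nest L j z κ ⟨hx, hxe⟩ hpν))

omit [NormedAlgebra ℂ 𝔸] [CompleteSpace 𝔸] in
/-- The restriction `A|_{box}` (zero outside the bonds of the box) is bounded by any common bound of `A` on the bonds of the
box. [folklore] -/
private theorem norm_insCfg_restr_le {lo hi : Site d} {A : Site d → Fin d → 𝔸} {a : ℝ} (ha : 0 ≤ a)
    (hA : ∀ x μ, BondIn lo hi x μ → ‖A x μ‖ ≤ a) (x : Site d) (μ : Fin d) :
    ‖insCfg (bondsIn lo hi) (restr (bondsIn lo hi) A) x μ‖ ≤ a := by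
  by_cases h : (x, μ) ∈ bondsIn lo hi
  · rw [insCfg_restr_of_mem _ _ h]; exact hA x μ (mem_bondsIn.mp h)
  · simp only [insCfg, h, dite_false, norm_zero]; exact ha

/-- The box `B^j(c₋) ∪ B^j(c₊)` is a genuine box: `loK ≤ bondHiK` coordinatewise (`L ≥ 1`). [folklore] -/
private theorem loK_le_bondHiK {L : ℕ} (hL : 1 ≤ L) (j : ℕ) (z : Site d) (κ : Fin d) (i : Fin d) :
    loK L j z i ≤ bondHiK L j z κ i := by
  have hP : (1 : ℤ) ≤ (L : ℤ) ^ j := one_le_pow₀ (by exact_mod_cast hL)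
  simp only [loK, bondHiK]
  split_ifs <;> omega

end Locality

/-! ## §2 (1.56) at one bond from the data in the box `B^j(c₋) ∪ B^j(c₊)` -/

section Eq156

variable {𝔸 : Type*} [NormedRing 𝔸] [NormOneClass 𝔸] [NormedAlgebra ℂ 𝔸] [CompleteSpace 𝔸]

/-- **(1.56) AT ONE BOND `c = ⟨z, z + e_κ⟩` OF THE `j`-LATTICE FROM BOX DATA**: for `U₀` with values in an averaging-closed
`G ≤ U1` whose plaquettes INSIDE `B^j(c₋) ∪ B^j(c₊)` obey (1.40) at level `j`, `|U₀(∂p) − 1| < α₀L^{−2j}`, and a field `A`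
with (1.41) `|A(b)| ≤ α₂(Lʲη)⁻¹` on the bonds `b` of that box, under the windows of `B8Eq156Prop4.eq156_of_141`:
`|C_j(LʲηA)(c)| = ‖Q_j(U₀, ηA)(c) − LʲηQ_jA(c)‖ ≤ C₂(d, α₀)·α₂²`. [cite: Balaban1985RegularSpaces, (1.56) p.86; Balaban1985Averaging, Prop. 4 p.38, p.24] -/
theorem eq156_loc {η : ℝ} (hη : 0 < η) (L : ℕ) (hL : 2 ≤ L) {G : Subgroup 𝔸ˣ} (hG : AvgClosed d L G) (j : ℕ)
    (U₀ : Site d → Fin d → 𝔸ˣ) (hU₀ : ∀ x κ, U₀ x κ ∈ G) {α₀ : ℝ} (hα₀ : 0 < α₀)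
    (hα3 : C0 d * α₀ ≤ 1 / 3) (hα4 : 4 * α₀ ≤ c2' d L) (z : Site d) (κ : Fin d)
    (h40 : ∀ (x : Site d) (μ ν : Fin d), μ ≠ ν → PlaqIn (loK L j z) (bondHiK L j z κ) (x, μ, ν) →
      ‖plaqF U₀ μ ν x - 1‖ < α₀ * (((L : ℝ) ^ j)⁻¹) ^ 2)
    (A : Site d → Fin d → 𝔸) {α₂ : ℝ} (hα₂ : 0 ≤ α₂)
    (h41 : ∀ x μ, BondIn (loK L j z) (bondHiK L j z κ) x μ → ‖A x μ‖ ≤ α₂ * ((L : ℝ) ^ j * η)⁻¹)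
    (hsmall : Real.exp (4 * (800 * ((d : ℝ) + 1) ^ 2 * ((d : ℝ) + 4)) * α₀)
      * (1 + 8 * (131072 * ((d : ℝ) + 1) ^ 2) * α₂) ≤ 2)
    (hc₃ : 2 * α₂ ≤ c3 d L) :
    ‖logCovIter L U₀ (iEta η A) j z κ - linCovIter L U₀ (iEta η A) j z κ‖
      ≤ 8 * (131072 * ((d : ℝ) + 1) ^ 2) * Real.exp (4 * (800 * ((d : ℝ) + 1) ^ 2 * ((d : ℝ) + 4)) * α₀)
        * α₂ ^ 2 := by
  have hL1 : 1 ≤ L := le_trans (by norm_num) hL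
  have hlohi : ∀ i, loK L j z i ≤ bondHiK L j z κ i := loK_le_bondHiK hL1 j z κ
  have hU₀U1 : ∀ x μ, U₀ x μ ∈ U1 𝔸 := fun x μ => hG.le_U1 (hU₀ x μ)
  -- the clamped extension `π^*U₀` and its global (1.40) at level `j`
  have hU₀'G : ∀ x μ, clampCfg (loK L j z) (bondHiK L j z κ) U₀ x μ ∈ G := clampCfg_mem hU₀
  have hpdOn : B7Prop1Local.pdevOn (loK L j z) (bondHiK L j z κ) U₀ < α₀ * (((L : ℝ) ^ j)⁻¹) ^ 2 := by
    refine pdevOn_lt_of_forall (by positivity) fun x μ ν hx hx' => ?_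
    rcases eq_or_ne μ ν with rfl | hμν
    · rw [B7Prop2Explicit.hol_plaqWord_self, Units.val_one, sub_self, norm_zero]; positivity
    · exact h40 x μ ν hμν ⟨hx, hx'⟩
  have hpdev : pdev (clampCfg (loK L j z) (bondHiK L j z κ) U₀) < α₀ * (((L : ℝ) ^ j)⁻¹) ^ 2 :=
    (pdev_clampCfg_le hlohi hU₀U1).trans_lt hpdOn
  -- the restriction `A|_{box}` and its global (1.41) at level `j`
  have hA' : ∀ x μ, ‖insCfg (bondsIn (loK L j z) (bondHiK L j z κ))
      (restr (bondsIn (loK L j z) (bondHiK L j z κ)) A) x μ‖ ≤ α₂ * ((L : ℝ) ^ j * η)⁻¹ :=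
    norm_insCfg_restr_le (by positivity) h41
  -- the global (1.56) for the modified pair
  have key := eq156_of_141 hη L hL hG j (clampCfg (loK L j z) (bondHiK L j z κ) U₀) hU₀'G hα₀ hα3 hα4 hpdev
    (insCfg (bondsIn (loK L j z) (bondHiK L j z κ)) (restr (bondsIn (loK L j z) (bondHiK L j z κ)) A)) hα₂ hA'
    hsmall hc₃ z κ
  -- transport back by locality
  have hagU : AgreeOn (loK L j z) (bondHiK L j z κ) (clampCfg (loK L j z) (bondHiK L j z κ) U₀) U₀ :=
    clampCfg_agree U₀
  have hagA : AgreeOn (loK L j z) (bondHiK L j z κ)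
      (iEta η (insCfg (bondsIn (loK L j z) (bondHiK L j z κ)) (restr (bondsIn (loK L j z) (bondHiK L j z κ)) A)))
      (iEta η A) := fun x μ hx hxe => by
    show ((Complex.I : ℂ) * η) • insCfg (bondsIn (loK L j z) (bondHiK L j z κ))
        (restr (bondsIn (loK L j z) (bondHiK L j z κ)) A) x μ = ((Complex.I : ℂ) * η) • A x μ
    rw [← agreeOn_insCfg_restr (loK L j z) (bondHiK L j z κ) A x μ hx hxe]
  rw [logCovIter_congr L hL1 j z κ hagU hagA, linCovIter_congr L hL1 j z κ hagU hagA] at key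
  exact key

/-! ## §3 «|B₁| < 2dLα₁ + C₂α₂²» at one bond of `Λ_j` -/

/-- **«|B₁| < 2dLα₁ + C₂α₂²» AT ONE BOND OF `Λ_j` FROM BOX DATA**: under the hypotheses of `eq156_loc` and (1.42)
`‖Q_j(U₀, ηA)(c)‖ < 2dLα₁` at `c`: `‖LʲηQ_jA(c)‖ < 2dLα₁ + C₂(d, α₀)α₂²`. [cite: Balaban1985RegularSpaces, p.86 (sentence after (1.56))] -/
theorem norm_B1_lt_loc {η : ℝ} (hη : 0 < η) (L : ℕ) (hL : 2 ≤ L) {G : Subgroup 𝔸ˣ} (hG : AvgClosed d L G) (j : ℕ)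
    (U₀ : Site d → Fin d → 𝔸ˣ) (hU₀ : ∀ x κ, U₀ x κ ∈ G) {α₀ : ℝ} (hα₀ : 0 < α₀)
    (hα3 : C0 d * α₀ ≤ 1 / 3) (hα4 : 4 * α₀ ≤ c2' d L) (z : Site d) (κ : Fin d)
    (h40 : ∀ (x : Site d) (μ ν : Fin d), μ ≠ ν → PlaqIn (loK L j z) (bondHiK L j z κ) (x, μ, ν) →
      ‖plaqF U₀ μ ν x - 1‖ < α₀ * (((L : ℝ) ^ j)⁻¹) ^ 2)
    (A : Site d → Fin d → 𝔸) {α₂ : ℝ} (hα₂ : 0 ≤ α₂)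
    (h41 : ∀ x μ, BondIn (loK L j z) (bondHiK L j z κ) x μ → ‖A x μ‖ ≤ α₂ * ((L : ℝ) ^ j * η)⁻¹)
    (hsmall : Real.exp (4 * (800 * ((d : ℝ) + 1) ^ 2 * ((d : ℝ) + 4)) * α₀)
      * (1 + 8 * (131072 * ((d : ℝ) + 1) ^ 2) * α₂) ≤ 2)
    (hc₃ : 2 * α₂ ≤ c3 d L) {α₁ : ℝ} (h42 : ‖logCovIter L U₀ (iEta η A) j z κ‖ < 2 * d * L * α₁) :
    ‖linCovIter L U₀ (iEta η A) j z κ‖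
      < 2 * d * L * α₁ + 8 * (131072 * ((d : ℝ) + 1) ^ 2)
          * Real.exp (4 * (800 * ((d : ℝ) + 1) ^ 2 * ((d : ℝ) + 4)) * α₀) * α₂ ^ 2 := by
  have hC := eq156_loc hη L hL hG j U₀ hU₀ hα₀ hα3 hα4 z κ h40 A hα₂ h41 hsmall hc₃
  calc ‖linCovIter L U₀ (iEta η A) j z κ‖
      = ‖logCovIter L U₀ (iEta η A) j z κ
          - (logCovIter L U₀ (iEta η A) j z κ - linCovIter L U₀ (iEta η A) j z κ)‖ := by
        rw [← B1_eq]
    _ ≤ ‖logCovIter L U₀ (iEta η A) j z κ‖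
          + ‖logCovIter L U₀ (iEta η A) j z κ - linCovIter L U₀ (iEta η A) j z κ‖ := norm_sub_le _ _
    _ < _ := add_lt_add_of_lt_of_le h42 hC

end Eq156

/-! ## §4 The k-level form «on Λ_j, j = 0, 1, …, k» for a general family `{Ω_j}` -/

section KLevel

variable {𝔸 : Type*} [NormedRing 𝔸] [NormOneClass 𝔸] [NormedAlgebra ℂ 𝔸] [CompleteSpace 𝔸]

/-- **«|B₁| < 2dLα₁ + C₂α₂²» AT EVERY BOND OF EVERY `Λ_j`, `j ≤ k`, FROM THE LEVEL-WISE (1.40)/(1.41)/(1.42)**: let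
`Ω : ℕ → Set (Site d)` be the site domains and `Λ : ℕ → Set (Site d × Fin d)` the constraint bonds of the `j`-lattices,
with every site of the box `B^j(c₋) ∪ B^j(c₊)` of a `c ∈ Λ_j` in `Ω_j` («Λ_j ⊂ Ω_j^{(j)}», (1.5)); if `U₀ ∈ 𝔄_k({Ω_j}, α₀)`
(`InAk`), (1.41) `|A(b)| ≤ α₂(Lʲη)⁻¹` for the bonds touching `Ω_j` (`j ≤ k`), and (1.42) `‖Q_j(U₀, ηA)(c)‖ < 2dLα₁` on `Λ_j`,
then `‖LʲηQ_jA(c)‖ < 2dLα₁ + C₂(d, α₀)α₂²` for every `c ∈ Λ_j`, `j ≤ k`. [cite: Balaban1985RegularSpaces, p.86 (sentence after (1.56)); (1.40)–(1.42) p.83] -/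
theorem norm_B1_lt_kLevel {η : ℝ} (hη : 0 < η) (L : ℕ) (hL : 2 ≤ L) {G : Subgroup 𝔸ˣ} (hG : AvgClosed d L G) {k : ℕ}
    (U₀ : Site d → Fin d → 𝔸ˣ) (hU₀ : ∀ x κ, U₀ x κ ∈ G) {α₀ : ℝ} (hα₀ : 0 < α₀)
    (hα3 : C0 d * α₀ ≤ 1 / 3) (hα4 : 4 * α₀ ≤ c2' d L) (A : Site d → Fin d → 𝔸) {α₂ : ℝ} (hα₂ : 0 ≤ α₂)
    (hsmall : Real.exp (4 * (800 * ((d : ℝ) + 1) ^ 2 * ((d : ℝ) + 4)) * α₀)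
      * (1 + 8 * (131072 * ((d : ℝ) + 1) ^ 2) * α₂) ≤ 2)
    (hc₃ : 2 * α₂ ≤ c3 d L) {Ω : ℕ → Set (Site d)} {Λ : ℕ → Set (Site d × Fin d)}
    (hbox : ∀ j, j ≤ k → ∀ c ∈ Λ j, ∀ x, InBox (loK L j c.1) (bondHiK L j c.1 c.2) x → x ∈ Ω j)
    (h40 : InAk L k η α₀ Ω U₀)
    (h41 : ∀ j, j ≤ k → ∀ x μ, BondTouches (Ω j) x μ → ‖A x μ‖ ≤ α₂ * ((L : ℝ) ^ j * η)⁻¹)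
    {α₁ : ℝ} (h42 : ∀ j, j ≤ k → ∀ c ∈ Λ j, ‖logCovIter L U₀ (iEta η A) j c.1 c.2‖ < 2 * d * L * α₁)
    {j : ℕ} (hj : j ≤ k) {c : Site d × Fin d} (hc : c ∈ Λ j) :
    ‖linCovIter L U₀ (iEta η A) j c.1 c.2‖
      < 2 * d * L * α₁ + 8 * (131072 * ((d : ℝ) + 1) ^ 2)
          * Real.exp (4 * (800 * ((d : ℝ) + 1) ^ 2 * ((d : ℝ) + 4)) * α₀) * α₂ ^ 2 := by
  refine norm_B1_lt_loc hη L hL hG j U₀ hU₀ hα₀ hα3 hα4 c.1 c.2 (fun x μ ν hμν hp => ?_) A hα₂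
    (fun x μ hb => ?_) hsmall hc₃ (h42 j hj c hc)
  · -- the plaquette lies in the box, hence touches `Ω_j`: (1.7) at level `j`
    exact (h40 j hj).1 x μ ν hμν (Or.inl (hbox j hj c hc x hp.1))
  · -- the bond lies in the box, hence touches `Ω_j`: (1.41) at level `j`
    exact h41 j hj x μ (Or.inl (hbox j hj c hc x hb.1))

/-- **«|B₁| < 2dLα₁ + C₂α₂²» FOR THE k-LEVEL SUPREMUM** `|B₁| = sup_{j ≤ k} sup_{c ∈ Λ_j}‖LʲηQ_jA(c)‖` (the weight-`1`
instance of `B8Eq155JBound.wsup` over the index `{(j, c) : j ≤ k, c ∈ Λ_j}` — the shape of the hypothesis `h56` of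
`B8.apriori_160`), same hypotheses (`α₁ ≥ 0`): `|B₁| ≤ 2dLα₁ + C₂(d, α₀)α₂²`. [cite: Balaban1985RegularSpaces, p.86 (sentence after (1.56))] -/
theorem wsup_B1_le_kLevel {η : ℝ} (hη : 0 < η) (L : ℕ) (hL : 2 ≤ L) {G : Subgroup 𝔸ˣ} (hG : AvgClosed d L G) {k : ℕ}
    (U₀ : Site d → Fin d → 𝔸ˣ) (hU₀ : ∀ x κ, U₀ x κ ∈ G) {α₀ : ℝ} (hα₀ : 0 < α₀)
    (hα3 : C0 d * α₀ ≤ 1 / 3) (hα4 : 4 * α₀ ≤ c2' d L) (A : Site d → Fin d → 𝔸) {α₂ : ℝ} (hα₂ : 0 ≤ α₂)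
    (hsmall : Real.exp (4 * (800 * ((d : ℝ) + 1) ^ 2 * ((d : ℝ) + 4)) * α₀)
      * (1 + 8 * (131072 * ((d : ℝ) + 1) ^ 2) * α₂) ≤ 2)
    (hc₃ : 2 * α₂ ≤ c3 d L) {Ω : ℕ → Set (Site d)} {Λ : ℕ → Set (Site d × Fin d)}
    (hbox : ∀ j, j ≤ k → ∀ c ∈ Λ j, ∀ x, InBox (loK L j c.1) (bondHiK L j c.1 c.2) x → x ∈ Ω j)
    (h40 : InAk L k η α₀ Ω U₀)
    (h41 : ∀ j, j ≤ k → ∀ x μ, BondTouches (Ω j) x μ → ‖A x μ‖ ≤ α₂ * ((L : ℝ) ^ j * η)⁻¹)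
    {α₁ : ℝ} (hα₁ : 0 ≤ α₁) (h42 : ∀ j, j ≤ k → ∀ c ∈ Λ j, ‖logCovIter L U₀ (iEta η A) j c.1 c.2‖ < 2 * d * L * α₁) :
    wsup 1 (fun p : {p : ℕ × (Site d × Fin d) // p.1 ≤ k ∧ p.2 ∈ Λ p.1} =>
        linCovIter L U₀ (iEta η A) p.1.1 p.1.2.1 p.1.2.2)
      ≤ 2 * d * L * α₁ + 8 * (131072 * ((d : ℝ) + 1) ^ 2)
          * Real.exp (4 * (800 * ((d : ℝ) + 1) ^ 2 * ((d : ℝ) + 4)) * α₀) * α₂ ^ 2 := by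
  have hL' : (0 : ℝ) ≤ (L : ℝ) := Nat.cast_nonneg L
  have hd' : (0 : ℝ) ≤ (d : ℝ) := Nat.cast_nonneg d
  refine wsup_le (fun p => ?_) (by positivity)
  rw [one_mul]
  exact (norm_B1_lt_kLevel hη L hL hG U₀ hU₀ hα₀ hα3 hα4 A hα₂ hsmall hc₃ hbox h40 h41 h42 p.2.1 p.2.2).le

end KLevel

/-! ## §5 The box hypothesis from the admissibility record (1.3)/(1.4) (`B8ConstraintBonds.DomainSeq`) -/

section DomainSeqBox

open Literature.MathematicalPhysics.QuantumLattice (blockMap blockBase blockMap_blockBase)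
open B8ConstraintBonds (DomainSeq)

/-- Euclidean division: `a div P = w ↔ Pw ≦ a < Pw + P` (`P > 0`) (private copy of the lineage's lemma). [folklore] -/
private theorem ediv_eq_iff_of_pos {P : ℤ} (hP : 0 < P) {a w : ℤ} : a / P = w ↔ P * w ≤ a ∧ a < P * w + P := by
  rw [le_antisymm_iff, ← Int.lt_add_one_iff, Int.ediv_lt_iff_lt_mul hP, Int.le_ediv_iff_mul_le hP]
  have h1 : (w + 1) * P = P * w + P := by ring
  have h2 : w * P = P * w := mul_comm _ _
  rw [h1, h2]
  exact and_comm

/-- **A site of the box `B^j(c₋) ∪ B^j(c₊)`, `c = ⟨z, z + e_κ⟩` of the `j`-lattice, lies in the `j`-block of `z` or of `z + e_κ`**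
(`blockMap (L^j) x ∈ {z, z + e_κ}`; `L ≥ 1`). [cite: Balaban1985Averaging, p.24 («B^k(c₋) ∪ B^k(c₊)»); Balaban1985RegularSpaces, (1.5) p.77] -/
theorem blockMap_of_inBox_loK {L : ℕ} (hL : 1 ≤ L) (j : ℕ) (z : Site d) (κ : Fin d) {x : Site d}
    (hx : InBox (loK L j z) (bondHiK L j z κ) x) :
    blockMap (L ^ j) x = z ∨ blockMap (L ^ j) x = z + e κ := by
  have hP : (0 : ℤ) < (L : ℤ) ^ j := by positivity
  have hPc : ((L ^ j : ℕ) : ℤ) = (L : ℤ) ^ j := by push_cast; rfl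
  have coord : ∀ i, blockMap (L ^ j) x i = x i / (L : ℤ) ^ j := fun i => by
    show x i / ((L ^ j : ℕ) : ℤ) = _
    rw [hPc]
  -- coordinates `i ≠ κ` lie in the block of `z`
  have hne : ∀ i, i ≠ κ → blockMap (L ^ j) x i = z i := by
    intro i hi
    have h1 := (hx i).1
    have h2 := (hx i).2
    simp only [loK, bondHiK, if_neg hi, add_zero] at h1 h2
    rw [coord, ediv_eq_iff_of_pos hP]
    constructor <;> linarith
  rcases lt_or_ge (x κ) ((L : ℤ) ^ j * z κ + (L : ℤ) ^ j) with hκ | hκ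
  · left
    funext i
    by_cases hi : i = κ
    · subst hi
      have h1 := (hx i).1
      simp only [loK] at h1
      rw [coord, ediv_eq_iff_of_pos hP]
      exact ⟨h1, hκ⟩
    · exact hne i hi
  · right
    funext i
    by_cases hi : i = κ
    · subst hi
      have h2 : x i ≤ (L : ℤ) ^ j * z i + ((L : ℤ) ^ j - 1) + (L : ℤ) ^ j := by simpa [bondHiK] using (hx i).2
      rw [coord, ediv_eq_iff_of_pos hP, add_e_apply, if_pos rfl, mul_add, mul_one]
      exact ⟨hκ, by linarith⟩
    · rw [add_e_apply, if_neg hi, add_zero]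
      exact hne i hi

/-- The corner `L^j w` of the `j`-block of `w` is mapped back to `w`. [folklore] -/
private theorem blockMap_loK {L : ℕ} (hL : 1 ≤ L) (j : ℕ) (w : Site d) : blockMap (L ^ j) (loK L j w) = w := by
  have hL0 : 0 < L ^ j := pow_pos hL j
  haveI : NeZero (L ^ j) := ⟨hL0.ne'⟩
  have h : loK L j w = blockBase (L ^ j) w := by
    funext i; simp [loK, blockBase, Nat.cast_pow]
  rw [h, blockMap_blockBase]

/-- **THE BOX HYPOTHESIS OF §4 FROM THE ADMISSIBILITY RECORD**: under (1.3)/(1.4) in the sense of `B8ConstraintBonds.DomainSeq`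
(`Ω_j` a union of `j`-blocks, `sat`), if the two block corners `L^jz`, `L^j(z + e_κ)` of the bond `c = ⟨z, z + e_κ⟩` lie in `Ω_j`
(«c₋, c₊ ∈ Ω_j^{(j)}»), then every site of `B^j(c₋) ∪ B^j(c₊)` lies in `Ω_j` (= `Bʲ` of (1.5)).
[cite: Balaban1985RegularSpaces, (1.3)-(1.5) p.77] -/
theorem mem_of_inBox_of_domainSeq {L : ℕ} (hL : 1 ≤ L) {Ω : ℕ → Set (Site d)} (hΩ : DomainSeq L Ω) {j : ℕ}
    {z : Site d} {κ : Fin d} (hz : loK L j z ∈ Ω j) (hz' : loK L j (z + e κ) ∈ Ω j) {x : Site d}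
    (hx : InBox (loK L j z) (bondHiK L j z κ) x) : x ∈ Ω j := by
  rcases blockMap_of_inBox_loK hL j z κ hx with h | h
  · exact hΩ.sat j (loK L j z) x (by rw [blockMap_loK hL, h]) hz
  · exact hΩ.sat j (loK L j (z + e κ)) x (by rw [blockMap_loK hL, h]) hz'

/-- **`hbox` for constraint bonds with both block corners in `Ω_j`** along a `DomainSeq`: the hypothesis of `norm_B1_lt_kLevel` /
`wsup_B1_le_kLevel` holds for every family `Λ` with `c ∈ Λ_j ⇒ L^jc₋, L^jc₊ ∈ Ω_j` (e.g. the level-`j` bonds with both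
end-points in `Ω_j^{(j)}`). [cite: Balaban1985RegularSpaces, (1.3)-(1.5) p.77, (1.42) p.83] -/
theorem hbox_of_domainSeq {L : ℕ} (hL : 1 ≤ L) {Ω : ℕ → Set (Site d)} (hΩ : DomainSeq L Ω) {k : ℕ}
    {Λ : ℕ → Set (Site d × Fin d)}
    (hΛ : ∀ j, j ≤ k → ∀ c ∈ Λ j, loK L j c.1 ∈ Ω j ∧ loK L j (c.1 + e c.2) ∈ Ω j) :
    ∀ j, j ≤ k → ∀ c ∈ Λ j, ∀ x, InBox (loK L j c.1) (bondHiK L j c.1 c.2) x → x ∈ Ω j :=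
  fun j hj c hc _ hx => mem_of_inBox_of_domainSeq hL hΩ (hΛ j hj c hc).1 (hΛ j hj c hc).2 hx

end DomainSeqBox

#print axioms eq156_loc
#print axioms norm_B1_lt_loc
#print axioms norm_B1_lt_kLevel
#print axioms wsup_B1_le_kLevel
#print axioms hbox_of_domainSeq

end Literature.MathematicalPhysics.QuantumFieldTheory.Balaban1983to89.B8Eq156KLevelLocal

end
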